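import Summits.AtomisticToContinuum.HydrodynamicLimit.Theses.StrongClosureWeakBV
import Summits.AtomisticToContinuum.HydrodynamicLimit.Theorems.GeneralStrongClosure.Negative.VitaliWitness
import Literature.MathematicalPhysics.KineticTheory.HardSphereEulerLLN
import Literature.Analysis.FluidPDE.HardSphereAlexander

/-!
# Refutation of `StrongClosureWeakBV.GeneralStrongClosure` (stmt-AtomisticToContinuum-9395)

[refuted-misstated] The crux quantifies `∀ T : ℝ` over "classical solutions on `[0, T)`"
(`IsHardSphereEulerSolution σ T ρ u θ`) but the solution predicate, the packing guard and every
time clause of the conclusion range over `Set.Ico 0 T`, which is EMPTY for `T ≤ 0`: there the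
triple `(ρ, u, θ)` is arbitrary — in particular its `t = 0` slice need not be measurable — while
the conclusion (ii) still demands a JOINTLY MEASURABLE limit triple `(ρ', u', θ')` (clause (i) at a
negative horizon `T' < T ≤ 0` reduces to the measurability conjuncts of the inline weak-solution
notion `S3`) whose `t = 0` slice agrees a.e. with `(ρ 0, u 0, θ 0)`. The `t = 0` law of large
numbers hypothesis does NOT rescue measurability: the three targets are Bochner integrals, whose
junk value `0` on non-integrable integrands is exactly the true momentum limit of a gas at rest.

Witness (T = 0): constant profiles `a₀ = θ₀ = 1`, `u₀ = 0`; `σ` below the closure's `σ₀`, below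
the `σ₀` of the tree's local-Gibbs LLN (`localGibbs_lln_holds`) and below `1/2` (Alexander flows,
`HardSphereFlow.nonempty_torus_holds`); data `ρ 0 = ρ₀` (the LLN density), `u 0 = 𝟙_V • e₀` with
`V ⊆ 𝕋³` a VITALI SET (inner measure `0`, outer measure `> 0`, built here from a transversal of
`𝕋³ / ℤ(√2,√2,√2)`), `θ 0 = 1 − ‖u 0‖²/3` (so the energy density is unchanged pointwise). The LLN
hypothesis holds (density and energy targets coincide with the LLN's; the momentum target is `0`
either as a genuine integral — inner measure zero — or as the junk value), the conclusion forces
`𝟙_V • e₀` to be a.e. equal to a measurable function, whence `V` would be null: contradiction.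

Repaired statement C′ (believed to carry the intended content; this witness misses it): insert
`0 < T →` after `IsHardSphereEulerSolution σ T ρ u θ →` (for `T > 0` the solution predicate makes
the `t = 0` slices continuous), exactly the re-type already applied to `LocalGibbsFineScale`
(stmt-9905 → stmt-17712) for the same corner.
-/

namespace Summit.AtomisticToContinuum.HydrodynamicLimit.Theses.StrongClosureWeakBV
/-- **Record of the dropped route item `GeneralStrongClosure`** = stmt-AtomisticToContinuum-9395 (ledger signature verbatim; NOT a route
item): route StrongClosureWeakBV (2026-08-17T00:55Z) replaced the refuted `GeneralStrongClosure` (stmt-9395) by stmt-16991 under a new name. The declaration `Summit.AtomisticToContinuum.HydrodynamicLimit.Theses.StrongClosureWeakBV.GeneralStrongClosure`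
therefore no longer exists in the route file and this accepted module stopped elaborating (stale olean;
buildfix lane 2026-08-19). Re-created here under its original name so the result keeps building; the
statement of every previously accepted declaration in this file is unchanged. -/
def GeneralStrongClosure : Prop :=
  ∃ η₀ > (0 : ℝ), ∀ η, 0 < η → η ≤ η₀ → ∀ a₀ θ₀ : UnitAddTorus (Fin 3) → ℝ, ∀ u₀ : UnitAddTorus (Fin 3) → EuclideanSpace ℝ (Fin 3), Continuous a₀ → Continuous θ₀ → Continuous u₀ → (∀ x, 0 < a₀ x ∧ 0 < θ₀ x) → ∃ σ₀ > (0 : ℝ), ∀ σ, 0 < σ → σ < σ₀ → let W3 := fun (a : ℝ → UnitAddTorus (Fin 3) → ℝ) (F : ℝ → UnitAddTorus (Fin 3) → EuclideanSpace ℝ (Fin 3)) (φ : ℝ → UnitAddTorus (Fin 3) → ℝ) => (∫ t in Set.Ioi 0, ∫ x, (a t x * Literature.Analysis.FunctionSpaces.Torus.timeDeriv φ t x + inner ℝ (F t x) (Literature.Analysis.FunctionSpaces.Torus.gradient (φ t) x))) + ∫ x, a 0 x * φ 0 x; let S3 := fun (T : ℝ) (ρ θ : ℝ → UnitAddTorus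 (Fin 3) → ℝ) (u : ℝ → UnitAddTorus (Fin 3) → EuclideanSpace ℝ (Fin 3)) => let E := fun (t : ℝ) (x : UnitAddTorus (Fin 3)) => Literature.MathematicalPhysics.KineticTheory.totalEnergyDensity (ρ t x) (u t x) (θ t x); let p := fun (t : ℝ) (x : UnitAddTorus (Fin 3)) => Literature.MathematicalPhysics.KineticTheory.hsPressure σ (ρ t x) (θ t x); let H := fun (t : ℝ) (x : UnitAddTorus (Fin 3)) => -(ρ t x * (3 / 2 * Real.log (θ t x) - Real.log (ρ t x) - Literature.MathematicalPhysics.KineticTheory.hsExcessFreeEnergy (ρ t x * σ ^ 3))); (∀ f ∈ [ρ, θ], Measurable (Function.uncurry f)) ∧ Measurable (Function.uncurry u) ∧ (∀ t ∈ Set.Ico 0 T, Filter.Tendsto (fun s : ℝ => ∫ x, dist (ρ s x, u s x, θ s x) (ρ t x, u t x, θ t x)) (nhdsWithin t (Set.Ico 0 T)) (nhds 0)) ∧ ∀ φ : ℝ → UnitAddTorus (Fin 3) → ℝ, ContDiff ℝ (⊤ : ℕ∞) (Literature.Analysis.FunctionSpaces.Torus.stLift φ) → (∃ T' < T, ∀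 t, T' ≤ t → ∀ x, φ t x = 0) → W3 ρ (fun t x => ρ t x • u t x) φ = 0 ∧ (∀ i : Fin 3, W3 (fun t x => ρ t x * u t x i) (fun t x => (ρ t x * u t x i) • u t x + p t x • EuclideanSpace.single i (1 : ℝ)) φ = 0) ∧ W3 E (fun t x => (E t x + p t x) • u t x) φ = 0 ∧ ((∀ t x, 0 ≤ φ t x) → 0 ≤ W3 H (fun t x => H t x • u t x) φ); let B3 := fun (η m M T : ℝ) (ρ θ : ℝ → UnitAddTorus (Fin 3) → ℝ) (u : ℝ → UnitAddTorus (Fin 3) → EuclideanSpace ℝ (Fin 3)) => ∀ t ∈ Set.Ico 0 T, ∀ x, m ≤ ρ t x ∧ ρ t x ≤ M ∧ m ≤ θ t x ∧ θ t x ≤ M ∧ ‖u t x‖ ≤ M ∧ ρ t x * σ ^ 3 ≤ η; let ST := fun (N : ℕ) (z : Literature.Analysis.FluidPDE.Config (N + 1) (Fin 3) (UnitAddTorus (Fin 3))) (χ : UnitAddTorus (Fin 3) → ℝ) => (Literature.MathematicalPhysics.KineticTheory.empiricalDensityField z χ, Literature.MathematicalPhysics.KineticTheory.empiricalMomentumField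 z χ, Literature.MathematicalPhysics.KineticTheory.empiricalEnergyField z χ); ∀ T : ℝ, ∀ ρ θ : ℝ → UnitAddTorus (Fin 3) → ℝ, ∀ u : ℝ → UnitAddTorus (Fin 3) → EuclideanSpace ℝ (Fin 3), Literature.MathematicalPhysics.KineticTheory.IsHardSphereEulerSolution σ T ρ u θ → (∀ t ∈ Set.Ico 0 T, ∀ x, ρ t x * σ ^ 3 ≤ η) → ∀ Φ : ((N : ℕ) → Literature.Analysis.FluidPDE.HardSphereFlow (Literature.Analysis.FluidPDE.Torus.geometry (Fin 3)) (Literature.MathematicalPhysics.KineticTheory.hsDiameter σ N) (N + 1)), let Lw := fun N : ℕ => Literature.MathematicalPhysics.KineticTheory.localGibbsLaw σ a₀ u₀ θ₀ N (Φ N); let LLk := fun (k : ℕ → ℕ) (ρ θ : ℝ → UnitAddTorus (Fin 3) → ℝ) (u : ℝ → UnitAddTorus (Fin 3) → EuclideanSpace ℝ (Fin 3)) (t : ℝ) => ∀ χ : UnitAddTorus (Fin 3) → ℝ, Continuous χ → ∀ δ > (0 : ℝ), Filter.Tendsto (fun n : ℕ => Lw (k n) {z | δ < dist (ST (k n) ((Φ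 (k n)).flow t z) χ) (∫ x, χ x * ρ t x, ∫ x, (χ x * ρ t x) • u t x, ∫ x, χ x * Literature.MathematicalPhysics.KineticTheory.totalEnergyDensity (ρ t x) (u t x) (θ t x))}) Filter.atTop (nhds 0); Literature.MathematicalPhysics.KineticTheory.TendstoHydroFieldsAt Lw Φ ρ u θ 0 → ∀ κ : ℕ → ℕ, StrictMono κ → ∃ κ' : ℕ → ℕ, StrictMono κ' ∧ ∃ ρ' θ' : ℝ → UnitAddTorus (Fin 3) → ℝ, ∃ u' : ℝ → UnitAddTorus (Fin 3) → EuclideanSpace ℝ (Fin 3), (∀ T' < T, S3 T' ρ' θ' u' ∧ ∃ m M : ℝ, 0 < m ∧ B3 (2 * η) m M T' ρ' θ' u') ∧ (∀ᵐ x : UnitAddTorus (Fin 3), ρ' 0 x = ρ 0 x ∧ u' 0 x = u 0 x ∧ θ' 0 x = θ 0 x) ∧ ∀ t ∈ Set.Ico 0 T, LLk (κ ∘ κ') ρ' θ' u' t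
end Summit.AtomisticToContinuum.HydrodynamicLimit.Theses.StrongClosureWeakBV


noncomputable section

open MeasureTheory Set Filter Topology

namespace Summit.AtomisticToContinuum.HydrodynamicLimit.Theorems

open Literature.MathematicalPhysics.KineticTheory Literature.Analysis.FluidPDE
open GeneralStrongClosureNegative

/-- Refutes `StrongClosureWeakBV.GeneralStrongClosure` [refuted-misstated]: at the horizon
`T = 0` the classical-solution predicate and the packing guard are vacuous (`Set.Ico 0 0 = ∅`),
so the datum `(ρ, u, θ)` is arbitrary, yet the conclusion (ii) asks for a jointly measurable
triple agreeing a.e. with it at `t = 0`; witness: constant profiles `a₀ = θ₀ = 1, u₀ = 0`, small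
`σ`, Alexander flows, `ρ 0 =` the local-Gibbs LLN density, `u 0 = 𝟙_V • e₀` for a Vitali set
`V ⊆ 𝕋³`, `θ 0 = 1 − ‖u 0‖²/3` — the `t = 0` LLN hypothesis holds (momentum target `0` by inner
measure zero / Bochner junk), the conclusion would make `V` null. Repaired statement C′ (this
witness misses it): add the hypothesis `0 < T` after `IsHardSphereEulerSolution σ T ρ u θ →`
(the re-type already applied to `LocalGibbsFineScale`, stmt-17712). [folklore] -/
theorem StrongClosureWeakBVGeneralStrongClosure_refuted :
    ¬ Summit.AtomisticToContinuum.HydrodynamicLimit.Theses.StrongClosureWeakBV.GeneralStrongClosure := by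
  intro h
  obtain ⟨η₀, hη₀, H⟩ := h
  obtain ⟨σ₀, hσ₀, H2⟩ := H η₀ hη₀ le_rfl (fun _ => 1) (fun _ => 1) (fun _ => 0)
    continuous_const continuous_const continuous_const (fun _ => ⟨one_pos, one_pos⟩)
  -- the tree's law of large numbers for local Gibbs states at `t = 0`
  obtain ⟨σ₁, hσ₁, HL⟩ := localGibbs_lln_holds (fun _ => (1 : ℝ)) (fun _ => (1 : ℝ))
    (fun _ => (0 : V3)) continuous_const continuous_const continuous_const
    (fun _ => one_pos) (fun _ => one_pos)
  -- a common small reduced density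
  set m₀ : ℝ := min (min σ₀ σ₁) 1 with hm₀
  have hm₀pos : 0 < m₀ := lt_min (lt_min hσ₀ hσ₁) one_pos
  have hm₀σ₀ : m₀ ≤ σ₀ := (min_le_left _ _).trans (min_le_left _ _)
  have hm₀σ₁ : m₀ ≤ σ₁ := (min_le_left _ _).trans (min_le_right _ _)
  have hm₀one : m₀ ≤ 1 := min_le_right _ _
  set σ : ℝ := m₀ / 4 with hσdef
  have hσ : 0 < σ := by positivity
  have hσlt : σ < m₀ := by rw [hσdef]; linarith
  have hσ₀' : σ < σ₀ := hσlt.trans_le hm₀σ₀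
  have hσ₁' : σ < σ₁ := hσlt.trans_le hm₀σ₁
  have hσhalf : σ < 2⁻¹ := by rw [hσdef]; norm_num; linarith
  obtain ⟨ρ₀, -, -, HL2⟩ := HL σ hσ hσ₁'
  -- Alexander's hard-sphere flows at diameters `hsDiameter σ N ≤ σ < 1/2`
  have hΦ : ∀ N : ℕ, Nonempty (HardSphereFlow (Torus.geometry (Fin 3)) (hsDiameter σ N) (N + 1)) :=
    fun N => HardSphereFlow.nonempty_torus_holds (hsDiameter_pos hσ N)
      ((hsDiameter_le hσ.le N).trans_lt hσhalf) (N + 1)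
  let Φ : (N : ℕ) → HardSphereFlow (Torus.geometry (Fin 3)) (hsDiameter σ N) (N + 1) :=
    fun N => (hΦ N).some
  have HLLN := (HL2 Φ).2
  -- the Vitali set and the witness datum
  obtain ⟨V, hV1, hV2⟩ := exists_innerNull_measure_ne_zero_T3
  set w : V3 := EuclideanSpace.single 0 1 with hwdef
  have hw : w ≠ 0 := by
    intro h0
    have := congrArg (fun v : V3 => v 0) h0
    simp [hwdef] at this
  set g : T3 → ℝ := V.indicator fun _ => (1 : ℝ) with hgdef
  set ρρ : ℝ → T3 → ℝ := fun _ x => ρ₀ x with hρρ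
  set uu : ℝ → T3 → V3 := fun _ x => g x • w with huu
  set θθ : ℝ → T3 → ℝ := fun _ x => 1 - ‖g x • w‖ ^ 2 / 3 with hθθ
  -- the witness "classical solution" on the empty horizon `[0, 0)`
  have hIco : ∀ t : ℝ, t ∈ Set.Ico (0 : ℝ) 0 → False := fun t ht => by simp at ht
  have hsol : IsHardSphereEulerSolution σ 0 ρρ uu θθ :=
    ⟨isSmoothSpaceTimeOn_Ico_self _ _, isSmoothSpaceTimeOn_Ico_self _ _,
      isSmoothSpaceTimeOn_Ico_self _ _, fun t ht => (hIco t ht).elim, fun t ht => (hIco t ht).elim,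
      fun t ht => (hIco t ht).elim, fun t ht => (hIco t ht).elim, fun t ht => (hIco t ht).elim⟩
  have hpack : ∀ t ∈ Set.Ico (0 : ℝ) 0, ∀ x, ρρ t x * σ ^ 3 ≤ η₀ :=
    fun t ht => (hIco t ht).elim
  -- the `t = 0` LLN hypothesis holds for the witness
  have hLLN : TendstoHydroFieldsAt
      (fun N => localGibbsLaw σ (fun _ => (1 : ℝ)) (fun _ => (0 : V3)) (fun _ => (1 : ℝ)) N (Φ N))
      Φ ρρ uu θθ 0 := by
    intro χ hχ δ hδ
    obtain ⟨h1, h2, h3⟩ := HLLN χ hχ δ hδ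
    refine ⟨h1, ?_, ?_⟩
    · have e1 : (∫ x, (χ x * ρρ 0 x) • uu 0 x) =
          ∫ x, (χ x * (fun _ : ℝ => ρ₀) 0 x) • (fun _ : ℝ => fun _ : T3 => (0 : V3)) 0 x := by
        simp only [hρρ, huu, smul_zero, integral_zero]
        exact integral_smul_indicator_smul_eq_zero hV1 w χ ρ₀
      rw [e1]
      exact h2
    · have e3 : (fun x => χ x * totalEnergyDensity (ρρ 0 x) (uu 0 x) (θθ 0 x)) =
          fun x => χ x * totalEnergyDensity ((fun _ : ℝ => ρ₀) 0 x)
            ((fun _ : ℝ => fun _ : T3 => (0 : V3)) 0 x) ((fun _ : ℝ => fun _ : T3 => (1 : ℝ)) 0 x) := by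
        funext x
        simp only [hρρ, huu, hθθ, totalEnergyDensity, norm_zero]
        ring
      rw [e3]
      exact h3
  -- apply the crux along the identity subsequence
  obtain ⟨κ', -, ρ', θ', u', hS, hslice, -⟩ :=
    H2 σ hσ hσ₀' 0 ρρ θθ uu hsol hpack Φ hLLN id strictMono_id
  have hS1 := (hS (-1) (by norm_num)).1
  obtain ⟨-, hu'm, -, -⟩ := hS1
  have hm0 : Measurable (u' 0) := hu'm.of_uncurry_left
  have hae : (fun x => g x • w) =ᵐ[volume] u' 0 := by
    filter_upwards [hslice] with x hx
    exact hx.2.1.symm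
  have hgw : AEStronglyMeasurable (fun x => g x • w) volume :=
    ⟨u' 0, hm0.stronglyMeasurable, hae⟩
  have h0 : (fun x => g x • w) =ᵐ[volume] (0 : T3 → V3) :=
    ae_eq_zero_of_innerNull hV1 hgw (fun x hx => mem_of_indicator_smul_ne_zero hx)
  have hA0 : volume V = 0 := by
    refine measure_mono_null (fun x hx => ?_) (ae_iff.mp h0)
    simp only [Set.mem_setOf_eq, Pi.zero_apply]
    rw [hgdef, Set.indicator_of_mem hx, one_smul]
    exact hw
  exact hV2 hA0

end Summit.AtomisticToContinuum.HydrodynamicLimit.Theorems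

end
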